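import Literature.IUT.HodgeTheaters.GlobalFrobenioids
import Mathlib.Topology.Algebra.OpenSubgroup
import Mathlib.RingTheory.RootsOfUnity.PrimitiveRoots
import HarnessLib

/-!
# [IUTchI] Example 5.1 (v): the FIELD-LEVEL Kummer-rigidity law set of the layer-5 certificate row
# `IUTchI:Ex5.1(v)` (v0.4/v0.5 blocks) has NO model with FINITE `π₁^rat` (tightness datum, proof-only)

S. Mochizuki, *Inter-universal Teichmüller theory I*, kurims manuscript (May 2020), §5 Example 5.1 (i)/(v)
pp. 123–129: `π₁^rat(†𝒟^⊛)` is [an isomorph of] the absolute Galois group `Gal(L̄_C/L_C)` of the function field of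
`C_{F_mod}` (p. 123 l. 52 – p. 124 l. 13) and the Kummer map is injective ("the asserted injectivity", p. 127
l. 57–75, Kummer theory of the fields `L̄_C^H`) ([IUTchI] Ex 5.1 (v) pp.127–129) [claim: Mochizuki2012, status: disputed]
(D-0012 claim key; nothing disputed is asserted; no side is taken on [IUTchIII] Cor. 3.12).

Cell abc-iut, layer-5 certificate additive parts v0.4 `layer5_held_ex51v_v4_canonical` (`Layer5OfSV04.lean`) and
v0.5 `layer5_held_ex51v_v5_fieldLevel` (`Layer5OfSV05.lean`; closer abc-iut-w4-d056's
`NFBridgeRecon.existsUniqueCoricStructure_infκPair_fieldLevel`): conjunct 1 of row 1116 (E51/L29, ∞κ) is there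
derived from the DATUM side-conditions `hroot` (every nonzero element of `K_rat` has all `n`-th roots), `hprim`
(primitive `n`-th roots of unity of every order) and the LAW `h_Ex51v_div` ("Kummer theory of the fixed fields
`K_rat^H`": in the fixed field of an OPEN normal subgroup `H ≤ π₁^rat` a nonzero element which is infinitely
divisible inside that fixed field is `1`), plus order/divisor laws.  This file records the complement of
abc-iut-w5-d110's `NFBridgeRecon.not_laws_of_commutative` (p432142, "no ABELIAN model" for the v0.1/v0.2 lists):

* `NFBridgeRecon.not_fieldLevel_laws_of_finite` — the three binders `hroot`, `hprim`, `h_Ex51v_div` are JOINTLY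
  UNSATISFIABLE whenever `π₁^rat` is FINITE: a finite Hausdorff (profinite) group is discrete, so `⊥` is an open
  normal subgroup; its fixed field is all of `K_rat`, where by `hroot` EVERY nonzero element is infinitely divisible,
  so `h_Ex51v_div` forces `K_rat^× = {1}` — contradicting `hprim 2` (a primitive square root of unity is `≠ 1`).
* `NFBridgeRecon.infinite_piRat_of_fieldLevel_laws` — contrapositive: any datum satisfying the v0.5 side-conditions
  and the field-level Kummer law has INFINITE `π₁^rat`.

READING (honest framing).  A TIGHTNESS datum for the certificate's binder list, not a refutation: at the genuine
datum `π₁^rat = Gal(L̄_C/L_C)` is an infinite profinite group and `⊥` is not open, so nothing is claimed there;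
what the theorem shows is that — unlike the v0.1/v0.2 lists, which abc-iut-w4-d050 (p437599) and abc-iut-w5-d110
(p438177) inhabited at FINITE toys (`π₁^rat := S₃`) — every non-vacuity witness of the v0.4/v0.5 lists must carry
an INFINITE profinite Galois action (e.g. `G_ℚ ↷ ℚ̄`, abc-iut-w4-d050's annex A2), i.e. essentially arithmetic data.
PROOF-ONLY: no definition, no instance, no new Prop fact.  typed ≠ proved elsewhere; instantiated ≠ endorsed.
-/

namespace Literature.IUT.HodgeTheaters

namespace NFBridgeRecon

universe u

variable (N : NFBridgeRecon.{u})

/-- **No finite-`π₁^rat` model of the field-level law set.**  If `π₁^rat(†𝒟^⊛)` is finite, the binders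
`hroot` (all roots), `hprim` (all primitive roots of unity) and `h_Ex51v_div` (Kummer theory of the fixed fields of
OPEN normal subgroups) of `layer5_held_ex51v_v5_fieldLevel` / `existsUniqueCoricStructure_infκPair_fieldLevel`
cannot hold together: `⊥` is open, its fixed field is `K_rat`, every nonzero element is infinitely divisible there
by `hroot`, so `h_Ex51v_div` gives `ζ = 1` for the primitive square root of unity `ζ` of `hprim` — absurd.
([IUTchI] Ex 5.1 (v) pp.127–129) [claim: Mochizuki2012, status: disputed] -/
theorem not_fieldLevel_laws_of_finite [Finite N.piRat]
    (hroot : ∀ a : N.Krat, a ≠ 0 → ∀ n : ℕ, 0 < n → ∃ b : N.Krat, b ^ n = a)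
    (hprim : ∀ n : ℕ, 0 < n → ∃ ζ : N.Krat, IsPrimitiveRoot ζ n)
    (h_Ex51v_div : ∀ (H : OpenNormalSubgroup N.piRat) (a : N.Krat), a ≠ 0 → (∀ h : N.piRat, h ∈ H → h • a = a) →
      (∀ n : ℕ+, ∃ b : N.Krat, (∀ h : N.piRat, h ∈ H → h • b = b) ∧ b ^ (n : ℕ) = a) → a = 1) :
    False := by
  -- a finite Hausdorff group is discrete, so the trivial subgroup is open (and normal)
  have hopen : IsOpen ((⊥ : Subgroup N.piRat) : Set N.piRat) := isOpen_discrete _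
  let H0 : OpenNormalSubgroup N.piRat := { toOpenSubgroup := ⟨⊥, hopen⟩ }
  have hmem : ∀ h : N.piRat, h ∈ H0 → h = 1 := fun h hh => (Subgroup.mem_bot.mp hh)
  -- the primitive square root of unity
  obtain ⟨ζ, hζ⟩ := hprim 2 two_pos
  have hζ1 : ζ ≠ 1 := hζ.ne_one one_lt_two
  have hζ0 : ζ ≠ 0 := hζ.ne_zero two_ne_zero
  -- it is fixed by `⊥` and infinitely divisible in `K_rat = K_rat^⊥`, hence `= 1` by the Kummer law
  refine hζ1 (h_Ex51v_div H0 ζ hζ0 (fun h hh => by rw [hmem h hh, one_smul]) fun n => ?_)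
  obtain ⟨b, hb⟩ := hroot ζ hζ0 n n.pos
  exact ⟨b, fun h hh => by rw [hmem h hh, one_smul], hb⟩

/-- **Contrapositive.**  A datum satisfying the v0.5 side-conditions `hroot`, `hprim` and the field-level Kummer law
`h_Ex51v_div` has INFINITE `π₁^rat(†𝒟^⊛)` — as the genuine `Gal(L̄_C/L_C)`; every non-vacuity witness of the
v0.4/v0.5 binder lists is an infinite profinite Galois action. ([IUTchI] Ex 5.1 (v) pp.127–129)
[claim: Mochizuki2012, status: disputed] -/
theorem infinite_piRat_of_fieldLevel_laws
    (hroot : ∀ a : N.Krat, a ≠ 0 → ∀ n : ℕ, 0 < n → ∃ b : N.Krat, b ^ n = a)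
    (hprim : ∀ n : ℕ, 0 < n → ∃ ζ : N.Krat, IsPrimitiveRoot ζ n)
    (h_Ex51v_div : ∀ (H : OpenNormalSubgroup N.piRat) (a : N.Krat), a ≠ 0 → (∀ h : N.piRat, h ∈ H → h • a = a) →
      (∀ n : ℕ+, ∃ b : N.Krat, (∀ h : N.piRat, h ∈ H → h • b = b) ∧ b ^ (n : ℕ) = a) → a = 1) :
    Infinite N.piRat := by
  by_contra hfin
  rw [not_infinite_iff_finite] at hfin
  exact N.not_fieldLevel_laws_of_finite hroot hprim h_Ex51v_div

end NFBridgeRecon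

end Literature.IUT.HodgeTheaters
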